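import Mathlib
import HarnessLib
import Literature.MathematicalPhysics.QuantumLattice.HubbardGridCounterQuadraticTransport
import Summits.HubbardSuperconductivity.HubbardSuperconductivity.Theorems.KLProgrammeKLRegimeEngineScaleZeroResummedDecay

/-!
# K3 engine (gen-6 item `KLRegimeEngineV16`, stmt-HubbardSuperconductivity-20236), stub `stub_twoLeg_scale0` under (ρ2): the TORUS-level
# K-resummed covariance `M_T·C` read on the grid — `S_Nᵀ·(M_T·C)·S_N = M'·(S_Nᵀ·C·S_N)` and its decay constants

Cell gate-hubbard-kl, seat p3 g8 ((ρ2)(iii)-DECAY, part 2).  k3c5-p1's K-resummed representation is stated at TORUS level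
(`HubbardCounterQuadraticResummation`, `…TwoLegResummedChain`: `C̃ = M_T·C`, `M_T·(1 + C·S_K) = 1`, `S_K = of(N_K − N_Kᵀ)` the
antisymmetrised torus counterterm matrix of `neg_counterQuadratic_eq_sum`, e.g. `M_T = diagonal((1 + pκ)⁻¹)` for a normal `C`), while the
decay-weighted single-scale step runs on the GRID covariance `S_Nᵀ·C̃·S_N` (`GrassmannLinearSubstitution.effAction_map`,
`S_N = hubbardGridSub L M β N`).  By the grid-to-torus transport of the counterterm matrix
(`HubbardGridCounterQuadraticTransport.hubbardGridSub_mul_gridCounterAnti_mul_transpose`: `S_N·S_g·S_Nᵀ = S_K`,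
`S_g = of((−N_g) − (−N_g)ᵀ)`, `N_g = gridCounterMatrix L N β K`, `2M ≤ N`) and the push-through identity
(`WeightedRowSumResolvent.transpose_mul_resolvent_mul_mul`), the grid covariance of `C̃` IS the grid-dressed pulled-back covariance:

* **`gridSub_transpose_mul_resummed_mul_gridSub`** — `S_Nᵀ·(M_T·C)·S_N = M'·(S_Nᵀ·C·S_N)` for every `M'` with `M'·(1 + S_NᵀCS_N·S_g) = 1`;
* **`rowSum_gridSub_resummed_le` / `colSum_gridSub_resummed_le`** — hence the `gridLabelWt`-pair-weighted row / column sums of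
  `S_Nᵀ·C̃·S_N` are `≤ α/(1 − α·ν)` as soon as those of `S_Nᵀ·C·S_N` are `≤ α`, `(|β|/N)·Σ_z ‖Ǩ_L z‖(1 + |z|) ≤ ν` and `α·ν < 1`
  (part 1, `…EngineScaleZeroResummedDecay`) — the `hrow`/`hcol` inputs of `…WeightedEffectiveActionTruncationDB`/`…BiGradedDB` for the
  W-chain on `(C̃, V_U)`, with NO symbol analysis of `p̃ = p/(1 + pκ)`;
* `one_sub_resummed_mul_one_add_eq_one` — conversely an explicit torus dressing `M_T` from the grid one (Woodbury).

Everything is proved; no definitions, no named facts, no sorry.  `--supports stmt-HubbardSuperconductivity-20236` (helper).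
-/

noncomputable section

namespace Summit.HubbardSuperconductivity.HubbardSuperconductivity.Theorems.EngineV8

set_option linter.dupNamespace false -- summit = problem name (single-conjunct summit), D-0017

open Real Finset Literature.MathematicalPhysics.QuantumLattice Literature.Probability.LatticeModels
open Literature.Probability.LatticeModels.BattleFederbush
open scoped Matrix

variable {L M N : ℕ} [NeZero L] [NeZero N]

section Torus

variable {β : ℝ} {K : TrigPolyC4v} {C MT : Matrix (HubbardFieldIdx L M) (HubbardFieldIdx L M) ℂ}
  {M' : Matrix (GridLeg (GridPoint L N)) (GridLeg (GridPoint L N)) ℂ}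

/-- **The torus dressing in push-through position**: `M_T·(1 + C·S_K) = 1` with the literal antisymmetrised torus counterterm matrix
`S_K` is `M_T·(1 + C·S_N·S_g·S_Nᵀ) = 1` with the grid one (`S_N·S_g·S_Nᵀ = S_K`, `2M ≤ N`, `β ≠ 0`). -/
theorem resummed_hyp_gridForm (hβ : β ≠ 0) (hMN : 2 * M ≤ N)
    (hMT : MT * (1 + C * (Matrix.of fun X Y : HubbardFieldIdx L M =>
        (Matrix.of fun Z W : HubbardFieldIdx L M =>
            if Z.2 = 0 ∧ W = (Z.1, 1) then -(((K.eval (latticeMomentum L Z.1.1.2) / (β * (L : ℝ) ^ 2) : ℝ) : ℂ)) else 0) X Y -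
          (Matrix.of fun Z W : HubbardFieldIdx L M =>
            if Z.2 = 0 ∧ W = (Z.1, 1) then -(((K.eval (latticeMomentum L Z.1.1.2) / (β * (L : ℝ) ^ 2) : ℝ) : ℂ)) else 0) Y X)) = 1) :
    MT * (1 + C * hubbardGridSub L M β N *
      (Matrix.of fun X Y => (-gridCounterMatrix L N β K) X Y - (-gridCounterMatrix L N β K) Y X) * (hubbardGridSub L M β N)ᵀ) = 1 := by
  rw [← hubbardGridSub_mul_gridCounterAnti_mul_transpose hβ K hMN] at hMT
  simpa only [Matrix.mul_assoc] using hMT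

/-- **The grid covariance of the K-resummed torus covariance is the grid-dressed pulled-back covariance**:
`S_Nᵀ·(M_T·C)·S_N = M'·(S_Nᵀ·C·S_N)` whenever `M_T·(1 + C·S_K) = 1` (torus, literal `S_K = of(N_K − N_Kᵀ)`) and
`M'·(1 + S_NᵀCS_N·S_g) = 1` (grid, `S_g = of((−N_g) − (−N_g)ᵀ)`, `N_g = gridCounterMatrix L N β K`), `2M ≤ N`, `β ≠ 0`. -/
theorem gridSub_transpose_mul_resummed_mul_gridSub (hβ : β ≠ 0) (hMN : 2 * M ≤ N)
    (hMT : MT * (1 + C * (Matrix.of fun X Y : HubbardFieldIdx L M =>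
        (Matrix.of fun Z W : HubbardFieldIdx L M =>
            if Z.2 = 0 ∧ W = (Z.1, 1) then -(((K.eval (latticeMomentum L Z.1.1.2) / (β * (L : ℝ) ^ 2) : ℝ) : ℂ)) else 0) X Y -
          (Matrix.of fun Z W : HubbardFieldIdx L M =>
            if Z.2 = 0 ∧ W = (Z.1, 1) then -(((K.eval (latticeMomentum L Z.1.1.2) / (β * (L : ℝ) ^ 2) : ℝ) : ℂ)) else 0) Y X)) = 1)
    (hM' : M' * (1 + (hubbardGridSub L M β N)ᵀ * C * hubbardGridSub L M β N *
      (Matrix.of fun X Y => (-gridCounterMatrix L N β K) X Y - (-gridCounterMatrix L N β K) Y X)) = 1) :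
    (hubbardGridSub L M β N)ᵀ * (MT * C) * hubbardGridSub L M β N = M' * ((hubbardGridSub L M β N)ᵀ * C * hubbardGridSub L M β N) :=
  transpose_mul_resolvent_mul_mul (resummed_hyp_gridForm hβ hMN hMT) hM'

/-- **An explicit torus dressing from the grid one** (Woodbury): if `M'·(1 + S_NᵀCS_N·S_g) = 1` then
`(1 − C·S_N·S_g·M'·S_Nᵀ)·(1 + C·S_K) = 1` (`2M ≤ N`, `β ≠ 0`) — the torus-level resummation exists as soon as the grid-level one does. -/
theorem one_sub_resummed_mul_one_add_eq_one (hβ : β ≠ 0) (hMN : 2 * M ≤ N)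
    (hM' : M' * (1 + (hubbardGridSub L M β N)ᵀ * C * hubbardGridSub L M β N *
      (Matrix.of fun X Y => (-gridCounterMatrix L N β K) X Y - (-gridCounterMatrix L N β K) Y X)) = 1) :
    (1 - C * hubbardGridSub L M β N *
        (Matrix.of fun X Y => (-gridCounterMatrix L N β K) X Y - (-gridCounterMatrix L N β K) Y X) * M' * (hubbardGridSub L M β N)ᵀ) *
      (1 + C * (Matrix.of fun X Y : HubbardFieldIdx L M =>
        (Matrix.of fun Z W : HubbardFieldIdx L M =>
            if Z.2 = 0 ∧ W = (Z.1, 1) then -(((K.eval (latticeMomentum L Z.1.1.2) / (β * (L : ℝ) ^ 2) : ℝ) : ℂ)) else 0) X Y -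
          (Matrix.of fun Z W : HubbardFieldIdx L M =>
            if Z.2 = 0 ∧ W = (Z.1, 1) then -(((K.eval (latticeMomentum L Z.1.1.2) / (β * (L : ℝ) ^ 2) : ℝ) : ℂ)) else 0) Y X)) = 1 := by
  have h := one_sub_mul_resolvent_mul_one_add hM'
  rw [← hubbardGridSub_mul_gridCounterAnti_mul_transpose hβ K hMN]
  simpa only [Matrix.mul_assoc] using h

variable {β' α ν : ℝ}

/-- **Weighted row sums of the grid covariance of the K-resummed torus covariance**: with `M_T·(1 + C·S_K) = 1` on the torus, if the
pulled-back covariance `S_NᵀCS_N` has `gridLabelWt`-pair-weighted row sums `≤ α`, `(|β|/N)·Σ_z ‖Ǩ_L z‖(1 + |z|_{ℓ^∞}) ≤ ν` and `α·ν < 1`,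
then `S_Nᵀ·(M_T·C)·S_N` has weighted row sums `≤ α/(1 − α·ν)` (`2M ≤ N`, `β ≠ 0`, `β' ≥ 0`). -/
theorem rowSum_gridSub_resummed_le (hβ : β ≠ 0) (hMN : 2 * M ≤ N) (hβ' : 0 ≤ β')
    (hMT : MT * (1 + C * (Matrix.of fun X Y : HubbardFieldIdx L M =>
        (Matrix.of fun Z W : HubbardFieldIdx L M =>
            if Z.2 = 0 ∧ W = (Z.1, 1) then -(((K.eval (latticeMomentum L Z.1.1.2) / (β * (L : ℝ) ^ 2) : ℝ) : ℂ)) else 0) X Y -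
          (Matrix.of fun Z W : HubbardFieldIdx L M =>
            if Z.2 = 0 ∧ W = (Z.1, 1) then -(((K.eval (latticeMomentum L Z.1.1.2) / (β * (L : ℝ) ^ 2) : ℝ) : ℂ)) else 0) Y X)) = 1)
    (hG : ∀ X, ∑ Y, ‖((hubbardGridSub L M β N)ᵀ * C * hubbardGridSub L M β N) X Y‖ * gridLabelWt L N β' {gridLegPos X, gridLegPos Y} ≤ α)
    (hν : |β| / N * ∑ z : TorusSite 2 L, ‖framePosKernel L K z‖ * (1 + torusSiteDist z 0) ≤ ν) (hαν : α * ν < 1)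
    (X : GridLeg (GridPoint L N)) :
    ∑ Y, ‖((hubbardGridSub L M β N)ᵀ * (MT * C) * hubbardGridSub L M β N) X Y‖ * gridLabelWt L N β' {gridLegPos X, gridLegPos Y} ≤
      α / (1 - α * ν) :=
  rowSum_transpose_mul_resolvent_mul_mul_le (fun X Y => gridLabelWt L N β' {gridLegPos X, gridLegPos Y}) (one_le_gridLabelWt_legPair β')
    (gridLabelWt_legPair_submul hβ') (resummed_hyp_gridForm hβ hMN hMT) hG
    (fun X => (rowSum_gridCounterAnti_mul_gridLabelWt_le β hβ' K (norm_neg_gridCounterAnti_le β K) X).trans hν) hαν X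

/-- **Weighted column sums of the grid covariance of the K-resummed torus covariance** (row AND column hypotheses on `S_NᵀCS_N`):
`≤ α/(1 − α·ν)`. -/
theorem colSum_gridSub_resummed_le (hβ : β ≠ 0) (hMN : 2 * M ≤ N) (hβ' : 0 ≤ β')
    (hMT : MT * (1 + C * (Matrix.of fun X Y : HubbardFieldIdx L M =>
        (Matrix.of fun Z W : HubbardFieldIdx L M =>
            if Z.2 = 0 ∧ W = (Z.1, 1) then -(((K.eval (latticeMomentum L Z.1.1.2) / (β * (L : ℝ) ^ 2) : ℝ) : ℂ)) else 0) X Y -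
          (Matrix.of fun Z W : HubbardFieldIdx L M =>
            if Z.2 = 0 ∧ W = (Z.1, 1) then -(((K.eval (latticeMomentum L Z.1.1.2) / (β * (L : ℝ) ^ 2) : ℝ) : ℂ)) else 0) Y X)) = 1)
    (hG : ∀ X, ∑ Y, ‖((hubbardGridSub L M β N)ᵀ * C * hubbardGridSub L M β N) X Y‖ * gridLabelWt L N β' {gridLegPos X, gridLegPos Y} ≤ α)
    (hG' : ∀ Y, ∑ X, ‖((hubbardGridSub L M β N)ᵀ * C * hubbardGridSub L M β N) X Y‖ * gridLabelWt L N β' {gridLegPos X, gridLegPos Y} ≤ α)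
    (hν : |β| / N * ∑ z : TorusSite 2 L, ‖framePosKernel L K z‖ * (1 + torusSiteDist z 0) ≤ ν) (hαν : α * ν < 1)
    (Y : GridLeg (GridPoint L N)) :
    ∑ X, ‖((hubbardGridSub L M β N)ᵀ * (MT * C) * hubbardGridSub L M β N) X Y‖ * gridLabelWt L N β' {gridLegPos X, gridLegPos Y} ≤
      α / (1 - α * ν) :=
  colSum_transpose_mul_resolvent_mul_mul_le (fun X Y => gridLabelWt L N β' {gridLegPos X, gridLegPos Y}) (one_le_gridLabelWt_legPair β')
    (gridLabelWt_legPair_submul hβ') (resummed_hyp_gridForm hβ hMN hMT) hG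
    (fun X => (rowSum_gridCounterAnti_mul_gridLabelWt_le β hβ' K (norm_neg_gridCounterAnti_le β K) X).trans hν) hG'
    (fun Y => (colSum_gridCounterAnti_mul_gridLabelWt_le β hβ' K (norm_neg_gridCounterAnti_le β K) Y).trans hν) hαν Y

/-- **Factor two under half smallness**: if moreover `0 ≤ α` and `α·ν ≤ 1/2` then the weighted row sums of `S_Nᵀ·(M_T·C)·S_N` are `≤ 2α`. -/
theorem rowSum_gridSub_resummed_le_two_mul (hβ : β ≠ 0) (hMN : 2 * M ≤ N) (hβ' : 0 ≤ β')
    (hMT : MT * (1 + C * (Matrix.of fun X Y : HubbardFieldIdx L M =>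
        (Matrix.of fun Z W : HubbardFieldIdx L M =>
            if Z.2 = 0 ∧ W = (Z.1, 1) then -(((K.eval (latticeMomentum L Z.1.1.2) / (β * (L : ℝ) ^ 2) : ℝ) : ℂ)) else 0) X Y -
          (Matrix.of fun Z W : HubbardFieldIdx L M =>
            if Z.2 = 0 ∧ W = (Z.1, 1) then -(((K.eval (latticeMomentum L Z.1.1.2) / (β * (L : ℝ) ^ 2) : ℝ) : ℂ)) else 0) Y X)) = 1)
    (hG : ∀ X, ∑ Y, ‖((hubbardGridSub L M β N)ᵀ * C * hubbardGridSub L M β N) X Y‖ * gridLabelWt L N β' {gridLegPos X, gridLegPos Y} ≤ α)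
    (hν : |β| / N * ∑ z : TorusSite 2 L, ‖framePosKernel L K z‖ * (1 + torusSiteDist z 0) ≤ ν) (hα : 0 ≤ α) (hαν : α * ν ≤ 1 / 2)
    (X : GridLeg (GridPoint L N)) :
    ∑ Y, ‖((hubbardGridSub L M β N)ᵀ * (MT * C) * hubbardGridSub L M β N) X Y‖ * gridLabelWt L N β' {gridLegPos X, gridLegPos Y} ≤
      2 * α := by
  have h := rowSum_gridSub_resummed_le hβ hMN hβ' hMT hG hν (by linarith) X
  refine h.trans ?_
  rw [div_le_iff₀ (by linarith)]
  nlinarith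

end Torus

end Summit.HubbardSuperconductivity.HubbardSuperconductivity.Theorems.EngineV8

end
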